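import Summits.KontsevichZagierPeriods.KontsevichZagierPeriods.Theorems.HurwitzMicroSectorsNormalFormPrincipleLevelOneReduction
import Summits.KontsevichZagierPeriods.KontsevichZagierPeriods.Theorems.HurwitzMicroSectorsNormalFormPrincipleLevelOneRigidNumbers
import Summits.KontsevichZagierPeriods.KontsevichZagierPeriods.Theorems.HurwitzMicroSectorsNormalFormPrincipleLevelOneExistsRepDim
import Summits.KontsevichZagierPeriods.KontsevichZagierPeriods.Theorems.HurwitzMicroSectorsNormalFormPrincipleLevelOneExistsBandRepDim
import Summits.KontsevichZagierPeriods.KontsevichZagierPeriods.Theorems.HurwitzMicroSectorsNormalFormPrincipleLevelOneMergeBoxSubBandDim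
import Summits.KontsevichZagierPeriods.KontsevichZagierPeriods.Theorems.HurwitzMicroSectorsNormalFormPrincipleLevelOneBandSubLevelOneDim
import Summits.KontsevichZagierPeriods.KontsevichZagierPeriods.Theorems.HurwitzMicroSectorsNormalFormPrincipleLevelOneValueZetaRepDim
import Literature.NumberTheory.Transcendental.CalegariDimitrovTangL2Chi3Reduction
import Mathlib.NumberTheory.ZetaValues

/-!
# `NormalFormPrinciple` (stmt-KontsevichZagierPeriods-3869), line `SketchIdeator1` — the level-one box
# tower, I: the `ζ(j)` CARRIERS of the normal form and coordinate permutations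

Pure proof file (`--supports` the crux; registered sub-goals `exists_zetaCarriers`, `sum_carriers_mono`).
The LEVEL-ONE BOX TOWER of the leaf `stub_boxRigidity` (lead seat c7, cycle 9 of crux
stmt-KontsevichZagierPeriods-3869, line `SketchIdeator1`): all representations
`[(0,1)ʷ, P(x)/(1 − x₀⋯x_{w−1})]`, `P ∈ ℚ[x₀,…,x_{w−1}]`, `w ≥ 2` — the natural completion of the route's
diagonal Hurwitz rungs and of Beukers' integrals `∫_{(0,1)ʷ} dx/(1 − ∏xᵢ) = ζ(w)`; values
`Σ_{j=2}^{w} c_j ζ(j) + c₀` (off-diagonal monomials have values in the span of lower weights, e.g.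
`∫∫∫ z/(1−xyz) = ζ(2) − 1`). Engine (card `merge-gadget-join-rung` of the crux): the MERGE GADGET with
spectators — the substitution `z_last = y·x_last` along the last coordinate (rule 2,
`merge_box_sub_band_dim`) followed by one Newton–Leibniz move along `y` (rule 3, `band_sub_levelOne_dim`)
— sends a monomial whose last two exponents differ to a member of the tower ONE DIMENSION DOWN; a
coordinate permutation (rule 2) arranges that for every non-constant exponent vector; a constant exponent
vector is diagonal, `c(∏x)^a/(1 − ∏x) = c/(1 − ∏x) − c Σ_{i<a} (∏x)^i` (rule 1b), and polynomial boxes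
collapse to rational points (`boxPoly_exists_pt`). Normal form: `Σ_{j=2}^{w} [(0,1)ʲ, β_j/(1 − ∏x)] + [pt, q]`.
Sources: M. Kontsevich, D. Zagier, *Periods* (2001), §1.1–1.2; F. Beukers, Bull. LMS 11 (1979).
No definitions are introduced.

This file: the carriers `[(0,1)ʲ, β/(1 − ∏xᵢ)]` (existence from `exists_levelOneRep_dim`, additivity,
congruence, vanishing), families `B : (j : ℕ) → IntegralRep j` and the calculus of their sums over
`2 ≤ j ≤ d` modulo relations, their values `Σ β_j ζ(j)` (`value_zetaRep_dim`), and the reindexing of a tower monomial along a coordinate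
permutation (`reindex_monomial`).
-/

noncomputable section

open MeasureTheory Set
open scoped Polynomial
open Literature.NumberTheory.Transcendental Literature.NumberTheory.Transcendental.KZ
open Literature.ModelTheory.ExponentialFields (IsSemialgebraic)

namespace Summit.KontsevichZagierPeriods.HurwitzMicroSectors.NormalFormPrinciple.PiBox.LevelOne

open Summit.KontsevichZagierPeriods.HurwitzMicroSectors.NormalFormPrinciple.PiBox.Dlog
  (exists_ptCarrier value_pt pt_add_mem_relations pt_zero_mem_relations pt_congr_mem_relations)

/-! ## Composition (lead), part I: the `ζ`-carriers of the tower normal form -/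

/-! ### One carrier -/

/-- The `ζ(w)` carrier `[(0,1)ʷ, β/(1 − ∏ xᵢ)]` exists (`w ≥ 2`). [cite: KontsevichZagier2001, §1.1] -/
theorem exists_zetaRep_dim {w : ℕ} (hw : 2 ≤ w) (β : ℚ) :
    ∃ B : IntegralRep w, B.domain = {x | ∀ i, x i ∈ Set.Ioo (0:ℝ) 1} ∧
      EqOn B.integrand (fun x => (β : ℝ) / (1 - ∏ i, x i)) B.domain := by
  obtain ⟨B, hBd, hBi⟩ := exists_levelOneRep_dim hw (MvPolynomial.C β)
  exact ⟨B, hBd, fun x _ => by rw [hBi]; simp⟩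

/-- Additivity of a carrier in `β` (rule 1b). [cite: KontsevichZagier2001, §1.2 rule (1)] -/
theorem zetaRep_add_mem_relations_dim {w : ℕ} {β₁ β₂ : ℚ} (B B₁ B₂ : IntegralRep w)
    (hBd : B.domain = {x | ∀ i, x i ∈ Set.Ioo (0:ℝ) 1})
    (hBi : EqOn B.integrand (fun x => ((β₁ + β₂ : ℚ) : ℝ) / (1 - ∏ i, x i)) B.domain)
    (hB₁d : B₁.domain = {x | ∀ i, x i ∈ Set.Ioo (0:ℝ) 1})
    (hB₁i : EqOn B₁.integrand (fun x => (β₁ : ℝ) / (1 - ∏ i, x i)) B₁.domain)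
    (hB₂d : B₂.domain = {x | ∀ i, x i ∈ Set.Ioo (0:ℝ) 1})
    (hB₂i : EqOn B₂.integrand (fun x => (β₂ : ℝ) / (1 - ∏ i, x i)) B₂.domain) :
    of B - of B₁ - of B₂ ∈ relations := by
  refine integrandAddRel_subset_relations ⟨w, B, B₁, B₂, hB₁d.trans hBd.symm, hB₂d.trans hBd.symm,
    fun x hx => ?_, rfl⟩
  have hx₁ : x ∈ B₁.domain := by rw [hB₁d, ← hBd]; exact hx
  have hx₂ : x ∈ B₂.domain := by rw [hB₂d, ← hBd]; exact hx
  rw [Pi.add_apply, hBi hx, hB₁i hx₁, hB₂i hx₂]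
  push_cast
  ring

/-- Congruence of carriers with the same `β`. [cite: KontsevichZagier2001, §1.2 rule (1)] -/
theorem zetaRep_congr_mem_relations_dim {w : ℕ} {β : ℚ} (B B' : IntegralRep w)
    (hBd : B.domain = {x | ∀ i, x i ∈ Set.Ioo (0:ℝ) 1})
    (hBi : EqOn B.integrand (fun x => (β : ℝ) / (1 - ∏ i, x i)) B.domain)
    (hB'd : B'.domain = {x | ∀ i, x i ∈ Set.Ioo (0:ℝ) 1})
    (hB'i : EqOn B'.integrand (fun x => (β : ℝ) / (1 - ∏ i, x i)) B'.domain) :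
    of B - of B' ∈ relations :=
  of_sub_of_mem_relations_of_eqOn (hB'd.trans hBd.symm) fun x hx => by
    rw [hBi hx, hB'i (by rw [hB'd, ← hBd]; exact hx)]

/-- A carrier with `β = 0` is a relation. [cite: KontsevichZagier2001, §1.2 rule (1)] -/
theorem zetaRep_zero_mem_relations_dim {w : ℕ} (B : IntegralRep w)
    (hBi : EqOn B.integrand (fun x => ((0 : ℚ) : ℝ) / (1 - ∏ i, x i)) B.domain) :
    of B ∈ relations :=
  of_mem_relations_of_eqOn_zero B fun x hx => by rw [hBi hx]; simp

/-- A carrier and a carrier with the opposite `β` sum to a relation. [cite: KontsevichZagier2001, §1.2 rule (1)] -/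
theorem zetaRep_add_neg_mem_relations_dim {w : ℕ} {β : ℚ} (B B' : IntegralRep w)
    (hBd : B.domain = {x | ∀ i, x i ∈ Set.Ioo (0:ℝ) 1})
    (hBi : EqOn B.integrand (fun x => (β : ℝ) / (1 - ∏ i, x i)) B.domain)
    (hB'd : B'.domain = {x | ∀ i, x i ∈ Set.Ioo (0:ℝ) 1})
    (hB'i : EqOn B'.integrand (fun x => ((-β : ℚ) : ℝ) / (1 - ∏ i, x i)) B'.domain) :
    of B + of B' ∈ relations :=
  of_add_of_mem_relations_of_eqOn_neg (hB'd.trans hBd.symm) fun x hx => by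
    rw [Pi.neg_apply, hB'i (by rw [hB'd, ← hBd]; exact hx), hBi hx]
    push_cast
    ring

/-! ### Families of carriers `B : (j : ℕ) → IntegralRep j` and their sums over `2 ≤ j ≤ d` -/

/-- **A family of carriers exists for every coefficient vector** `β : ℕ → ℚ` (dimensions `j ≥ 2`; the
entries `j < 2` are irrelevant junk). [cite: KontsevichZagier2001, §1.1] -/
theorem exists_zetaCarriers (β : ℕ → ℚ) :
    ∃ B : (j : ℕ) → IntegralRep j, ∀ j, 2 ≤ j →
      (B j).domain = {x | ∀ i, x i ∈ Set.Ioo (0:ℝ) 1} ∧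
      EqOn (B j).integrand (fun x => (β j : ℝ) / (1 - ∏ i, x i)) (B j).domain := by
  classical
  have hz : ∀ j : ℕ, ∃ z : IntegralRep j, z.domain = univ ∧ z.integrand = 0 :=
    fun j => exists_zeroRep Literature.ModelTheory.ExponentialFields.isSemialgebraic_univ
  refine ⟨fun j => if h : 2 ≤ j then Classical.choose (exists_zetaRep_dim h (β j))
    else Classical.choose (hz j), fun j hj => ?_⟩
  simp only [dif_pos hj]
  exact Classical.choose_spec (exists_zetaRep_dim hj (β j))

/-- Termwise congruence of two carrier families with the same coefficients.
[cite: KontsevichZagier2001, §1.2 rule (1)] -/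
theorem sum_carriers_congr {d : ℕ} {β : ℕ → ℚ} (B B' : (j : ℕ) → IntegralRep j)
    (hB : ∀ j ∈ Finset.Icc 2 d, (B j).domain = {x | ∀ i, x i ∈ Set.Ioo (0:ℝ) 1} ∧
      EqOn (B j).integrand (fun x => (β j : ℝ) / (1 - ∏ i, x i)) (B j).domain)
    (hB' : ∀ j ∈ Finset.Icc 2 d, (B' j).domain = {x | ∀ i, x i ∈ Set.Ioo (0:ℝ) 1} ∧
      EqOn (B' j).integrand (fun x => (β j : ℝ) / (1 - ∏ i, x i)) (B' j).domain) :
    (∑ j ∈ Finset.Icc 2 d, of (B j)) - ∑ j ∈ Finset.Icc 2 d, of (B' j) ∈ relations := by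
  rw [← Finset.sum_sub_distrib]
  exact Finset.sum_induction _ (fun c => c ∈ relations) (fun _ _ => relations.add_mem)
    relations.zero_mem fun j hj =>
      zetaRep_congr_mem_relations_dim (B j) (B' j) (hB j hj).1 (hB j hj).2 (hB' j hj).1 (hB' j hj).2

/-- Termwise additivity of carrier families. [cite: KontsevichZagier2001, §1.2 rule (1)] -/
theorem sum_carriers_add {d : ℕ} {β₁ β₂ : ℕ → ℚ} (B B₁ B₂ : (j : ℕ) → IntegralRep j)
    (hB : ∀ j ∈ Finset.Icc 2 d, (B j).domain = {x | ∀ i, x i ∈ Set.Ioo (0:ℝ) 1} ∧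
      EqOn (B j).integrand (fun x => ((β₁ j + β₂ j : ℚ) : ℝ) / (1 - ∏ i, x i)) (B j).domain)
    (hB₁ : ∀ j ∈ Finset.Icc 2 d, (B₁ j).domain = {x | ∀ i, x i ∈ Set.Ioo (0:ℝ) 1} ∧
      EqOn (B₁ j).integrand (fun x => (β₁ j : ℝ) / (1 - ∏ i, x i)) (B₁ j).domain)
    (hB₂ : ∀ j ∈ Finset.Icc 2 d, (B₂ j).domain = {x | ∀ i, x i ∈ Set.Ioo (0:ℝ) 1} ∧
      EqOn (B₂ j).integrand (fun x => (β₂ j : ℝ) / (1 - ∏ i, x i)) (B₂ j).domain) :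
    (∑ j ∈ Finset.Icc 2 d, of (B j)) - (∑ j ∈ Finset.Icc 2 d, of (B₁ j)) -
      ∑ j ∈ Finset.Icc 2 d, of (B₂ j) ∈ relations := by
  rw [← Finset.sum_sub_distrib, ← Finset.sum_sub_distrib]
  exact Finset.sum_induction _ (fun c => c ∈ relations) (fun _ _ => relations.add_mem)
    relations.zero_mem fun j hj =>
      zetaRep_add_mem_relations_dim (B j) (B₁ j) (B₂ j) (hB j hj).1 (hB j hj).2 (hB₁ j hj).1
        (hB₁ j hj).2 (hB₂ j hj).1 (hB₂ j hj).2

/-- A carrier family with zero coefficients sums to a relation. [cite: KontsevichZagier2001, §1.2 rule (1)] -/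
theorem sum_carriers_zero {d : ℕ} {β : ℕ → ℚ} (B : (j : ℕ) → IntegralRep j)
    (hB : ∀ j ∈ Finset.Icc 2 d, (B j).domain = {x | ∀ i, x i ∈ Set.Ioo (0:ℝ) 1} ∧
      EqOn (B j).integrand (fun x => (β j : ℝ) / (1 - ∏ i, x i)) (B j).domain)
    (hβ : ∀ j ∈ Finset.Icc 2 d, β j = 0) :
    ∑ j ∈ Finset.Icc 2 d, of (B j) ∈ relations :=
  Finset.sum_induction _ (fun c => c ∈ relations) (fun _ _ => relations.add_mem)
    relations.zero_mem fun j hj =>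
      zetaRep_zero_mem_relations_dim (B j) (by rw [← hβ j hj]; exact (hB j hj).2)

/-- A carrier family and the family with opposite coefficients sum to a relation.
[cite: KontsevichZagier2001, §1.2 rule (1)] -/
theorem sum_carriers_add_neg {d : ℕ} {β : ℕ → ℚ} (B B' : (j : ℕ) → IntegralRep j)
    (hB : ∀ j ∈ Finset.Icc 2 d, (B j).domain = {x | ∀ i, x i ∈ Set.Ioo (0:ℝ) 1} ∧
      EqOn (B j).integrand (fun x => (β j : ℝ) / (1 - ∏ i, x i)) (B j).domain)
    (hB' : ∀ j ∈ Finset.Icc 2 d, (B' j).domain = {x | ∀ i, x i ∈ Set.Ioo (0:ℝ) 1} ∧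
      EqOn (B' j).integrand (fun x => ((-β j : ℚ) : ℝ) / (1 - ∏ i, x i)) (B' j).domain) :
    (∑ j ∈ Finset.Icc 2 d, of (B j)) + ∑ j ∈ Finset.Icc 2 d, of (B' j) ∈ relations := by
  rw [← Finset.sum_add_distrib]
  exact Finset.sum_induction _ (fun c => c ∈ relations) (fun _ _ => relations.add_mem)
    relations.zero_mem fun j hj =>
      zetaRep_add_neg_mem_relations_dim (B j) (B' j) (hB j hj).1 (hB j hj).2 (hB' j hj).1 (hB' j hj).2

/-- **A single carrier**: if `β` vanishes on `2 ≤ j ≤ d` except at `j₀`, the family sums to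
`[B j₀]` modulo relations. [cite: KontsevichZagier2001, §1.2 rule (1)] -/
theorem sum_carriers_single {d j₀ : ℕ} {β : ℕ → ℚ} (hj₀ : j₀ ∈ Finset.Icc 2 d)
    (B : (j : ℕ) → IntegralRep j)
    (hB : ∀ j ∈ Finset.Icc 2 d, (B j).domain = {x | ∀ i, x i ∈ Set.Ioo (0:ℝ) 1} ∧
      EqOn (B j).integrand (fun x => (β j : ℝ) / (1 - ∏ i, x i)) (B j).domain)
    (hβ : ∀ j ∈ Finset.Icc 2 d, j ≠ j₀ → β j = 0) :
    (∑ j ∈ Finset.Icc 2 d, of (B j)) - of (B j₀) ∈ relations := by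
  rw [← Finset.add_sum_erase _ _ hj₀, add_sub_cancel_left]
  exact Finset.sum_induction _ (fun c => c ∈ relations) (fun _ _ => relations.add_mem)
    relations.zero_mem fun j hj => by
      have hj' : j ∈ Finset.Icc 2 d := Finset.mem_of_mem_erase hj
      exact zetaRep_zero_mem_relations_dim (B j)
        (by rw [← hβ j hj' (Finset.ne_of_mem_erase hj)]; exact (hB j hj').2)

/-- **Monotonicity in the height**: for `d ≤ d'` and `β` vanishing above `d`, the sums over
`2 ≤ j ≤ d'` and `2 ≤ j ≤ d` differ by a relation. [cite: KontsevichZagier2001, §1.2 rule (1)] -/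
theorem sum_carriers_mono {d d' : ℕ} (hdd' : d ≤ d') {β : ℕ → ℚ} (B : (j : ℕ) → IntegralRep j)
    (hB : ∀ j ∈ Finset.Icc 2 d', (B j).domain = {x | ∀ i, x i ∈ Set.Ioo (0:ℝ) 1} ∧
      EqOn (B j).integrand (fun x => (β j : ℝ) / (1 - ∏ i, x i)) (B j).domain)
    (hβ : ∀ j, d < j → β j = 0) :
    (∑ j ∈ Finset.Icc 2 d', of (B j)) - ∑ j ∈ Finset.Icc 2 d, of (B j) ∈ relations := by
  have hsub : Finset.Icc 2 d ⊆ Finset.Icc 2 d' := Finset.Icc_subset_Icc_right hdd'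
  rw [← Finset.sum_sdiff hsub, add_sub_cancel_right]
  exact Finset.sum_induction _ (fun c => c ∈ relations) (fun _ _ => relations.add_mem)
    relations.zero_mem fun j hj => by
      rw [Finset.mem_sdiff] at hj
      have hdj : d < j := by
        have h1 := (Finset.mem_Icc.1 hj.1).1
        by_contra h
        exact hj.2 (Finset.mem_Icc.2 ⟨h1, not_lt.1 h⟩)
      exact zetaRep_zero_mem_relations_dim (B j) (by rw [← hβ j hdj]; exact (hB j hj.1).2)

/-- **Values of a carrier family**: `eval (Σ_{2≤j≤d} [B j]) = Σ_{2≤j≤d} β_j ζ(j)`.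
[cite: KontsevichZagier2001, §1.1] -/
theorem eval_sum_carriers {d : ℕ} {β : ℕ → ℚ} (B : (j : ℕ) → IntegralRep j)
    (hB : ∀ j ∈ Finset.Icc 2 d, (B j).domain = {x | ∀ i, x i ∈ Set.Ioo (0:ℝ) 1} ∧
      EqOn (B j).integrand (fun x => (β j : ℝ) / (1 - ∏ i, x i)) (B j).domain) :
    eval (∑ j ∈ Finset.Icc 2 d, of (B j)) = ∑ j ∈ Finset.Icc 2 d, (β j : ℝ) * zetaValue j := by
  rw [map_sum]
  refine Finset.sum_congr rfl fun j hj => ?_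
  rw [eval_of]
  exact value_zetaRep_dim (Finset.mem_Icc.1 hj).1 (β j) (B j) (hB j hj).1 (hB j hj).2

/-! ### Permutations of the coordinates -/

/-- **Permuting the coordinates of a level-one box monomial** (rule 2, `KZ.IntegralRep.reindex`):
`[(0,1)ⁿ, c ∏ xᵢ^{s i}/(1 − ∏ xᵢ)]` reindexed along `σ` is `[(0,1)ⁿ, c ∏ x_m^{s (σ⁻¹ m)}/(1 − ∏ x_m)]`
on the box. [cite: KontsevichZagier2001, §1.2 rule (2)] -/
theorem reindex_monomial {n : ℕ} (σ : Equiv.Perm (Fin n)) (s : Fin n → ℕ) (c : ℚ) (N : IntegralRep n)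
    (hNd : N.domain = {x | ∀ i, x i ∈ Set.Ioo (0:ℝ) 1})
    (hNi : EqOn N.integrand (fun x => (c : ℝ) * (∏ i, x i ^ s i) / (1 - ∏ i, x i)) N.domain) :
    (N.reindex σ).domain = {x | ∀ i, x i ∈ Set.Ioo (0:ℝ) 1} ∧
      EqOn (N.reindex σ).integrand
        (fun x => (c : ℝ) * (∏ m, x m ^ s (σ.symm m)) / (1 - ∏ m, x m)) (N.reindex σ).domain := by
  have hd : (N.reindex σ).domain = {x | ∀ i, x i ∈ Set.Ioo (0:ℝ) 1} := by
    ext w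
    simp only [IntegralRep.reindex_domain, hNd, mem_setOf_eq]
    exact ⟨fun h i => by simpa using h (σ.symm i), fun h i => h (σ i)⟩
  refine ⟨hd, fun w hw => ?_⟩
  have hw' : (fun i => w (σ i)) ∈ N.domain := by
    rw [IntegralRep.reindex_domain] at hw
    exact hw
  rw [IntegralRep.reindex_integrand]
  show N.integrand (fun i => w (σ i)) = _
  rw [hNi hw']
  simp only []
  rw [Equiv.prod_comp σ (fun m => w m), ← Equiv.prod_comp σ (fun m => w m ^ s (σ.symm m))]
  simp only [Equiv.symm_apply_apply]

end Summit.KontsevichZagierPeriods.HurwitzMicroSectors.NormalFormPrinciple.PiBox.LevelOne
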